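import Summits.Ventures.PercRepro.Night2ShadowForm
import Summits.Ventures.PercRepro.RankLevelSetF

/-!
# PercRepro — the shadow form at the diagonal: the contraction regime of the inductive step (night-2, gen 5)

`Night2ShadowForm.lean` proves the e-LEMMA: at `(q + 2, q)` a family `𝒜 ⊆ Uq` whose closures MISS a ground element `e`
satisfies the shadow condition outright.  This file proves the opposite regime from the induction hypotheses on the
two single-element minors: if `e` lies in the closure of EVERY member of `𝒜`, then the shadow condition for `𝒜` at
`Φ(q + 2, q) = (q + 2)/(q + 1)` follows from `ShadowHall (M ／ {e}) (q + 1) (q − 1) ((q + 1)/q)` and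
`ShadowHall (M ＼ {e}) (q + 2) q ((q + 2)/(q + 1))`:

* `gr_contract`, `gr_delete`: the ground finsets of `M ／ {e}` and `M ＼ {e}` are `(gr M).erase e`;
* `erase_mem_Uq_contract`: for `B ∈ Uq M (q + 2) q` with `e ∈ cl B`, `B ∖ {e}` is a bottom set of `M ／ {e}` at
  `(q + 1, q − 1)` (`r_{M/e}(B ∖ e) + 1 = r_M(B ∪ e) = r_M(B) = q`; the complement keeps rank `q + 2` in `M`, hence
  `q + 1` in `M ／ {e}` — here `r(M) = q + 2` is used);
* `insert_mem_shadow_of_contract`: a middle-level set of `M ／ {e}` above `B ∖ {e}` gives, with `e` added, a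
  middle-level set of `M` above `B` (rank `q + 1`);
* `mem_Uq_delete_of_insert_mem`: a «collision» member `B ∌ e` with `B ∪ {e} ∈ 𝒜` is a bottom set of `M ＼ {e}` at
  `(q + 2, q)` (its complement in `M ＼ {e}` is the complement of `B ∪ {e}` in `M`), and the middle-level sets of
  `M ＼ {e}` above it are middle-level sets of `M` above it (`shadow_delete_subset`);
* **`shadow_card_of_mem_closure`**: the count.  `B ↦ B ∖ {e}` is injective off the collision members, so
  `#𝒜 ≤ #𝒜′ + #𝒞`; the `M ／ {e}`-shadow of `𝒜′` lands injectively in the sets containing `e`, the `M ＼ {e}`-shadow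
  of `𝒞` in the sets avoiding `e`; `((q+1)/q)·#𝒜′ + ((q+2)/(q+1))·#𝒞 ≥ ((q+2)/(q+1))·#𝒜`.
Together with the e-lemma, the inductive step of the diagonal shadow form is a theorem in its two extreme regimes
(an element outside every closure / an element inside every closure); the mixed families are the open case
(`proofs/NIGHT-2-shadow.md` §5, §7).
-/

open scoped Matroid

namespace PercRepro.Shadow

open Finset PerFlat ThmH

variable {α : Type} [DecidableEq α] {M : Matroid α} [M.Finite]

/-- The ground finset of `M ／ {e}`. -/
theorem gr_contract (e : α) : gr (M ／ ({e} : Set α)) = (gr M).erase e := by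
  apply Finset.coe_injective
  rw [coe_gr, Matroid.contract_ground, Finset.coe_erase, coe_gr]

/-- The ground finset of `M ＼ {e}`. -/
theorem gr_delete (e : α) : gr (M ＼ ({e} : Set α)) = (gr M).erase e := by
  apply Finset.coe_injective
  rw [coe_gr, Matroid.delete_ground, Finset.coe_erase, coe_gr]

omit [DecidableEq α] in
/-- A finite rank value below `⊤` is a natural number. -/
theorem exists_nat_eq_eRk (N : Matroid α) (X : Finset α) : ∃ m : ℕ, (m : ℕ∞) = N.eRk (X : Set α) := by
  apply ENat.ne_top_iff_exists.1
  have h := N.eRk_le_encard (X : Set α)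
  rw [Set.encard_coe_eq_coe_finsetCard] at h
  exact ne_top_of_le_ne_top (ENat.coe_ne_top _) h

section Contract

variable {q : ℕ} {e : α}

/-- `(gr M).erase e \ B.erase e = (gr M \ B).erase e`. -/
theorem erase_sdiff_erase (B : Finset α) : (gr M).erase e \ B.erase e = (gr M \ B).erase e := by
  ext x
  simp only [Finset.mem_sdiff, Finset.mem_erase]
  tauto

/-- For a bottom set `B` at `(q + 2, q)` with `e ∈ cl B`, `B ∖ {e}` is a bottom set of `M ／ {e}` at `(q + 1, q − 1)`. -/
theorem erase_mem_Uq_contract (he : M.Indep {e}) (hq : 1 ≤ q) (hM : M.eRank = ((q + 2 : ℕ) : ℕ∞))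
    {B : Finset α} (hB : B ∈ Uq M (q + 2) q) (hcl : e ∈ clF M B) :
    B.erase e ∈ Uq (M ／ ({e} : Set α)) (q + 1) (q - 1) := by
  rw [mem_Uq] at hB ⊢
  obtain ⟨hBg, hBq, hBc⟩ := hB
  have heE : e ∈ M.E := he.subset_ground (Set.mem_singleton e)
  have hecl : e ∈ M.closure (B : Set α) := by rw [← coe_clF]; exact_mod_cast hcl
  refine ⟨?_, ?_, ?_⟩
  · rw [gr_contract]
    exact Finset.erase_subset_erase e hBg
  · -- rank of B ∖ {e} in M ／ {e}
    have hX : ((B.erase e : Finset α) : Set α) ⊆ M.E \ {e} := by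
      rw [Finset.coe_erase]
      exact Set.sdiff_subset_sdiff_left (by rw [← coe_gr]; exact_mod_cast hBg)
    have h1 := contract_singleton_eRk_add_one he hX
    have h2 : insert e ((B.erase e : Finset α) : Set α) = insert e (B : Set α) := by
      rw [Finset.coe_erase, Set.insert_sdiff_singleton]
    rw [h2, eRk_insert_eq_of_mem_closure (by rw [← coe_gr]; exact_mod_cast hBg) hecl, hBq] at h1
    obtain ⟨m, hm⟩ := exists_nat_eq_eRk (M ／ ({e} : Set α)) (B.erase e)
    rw [← hm] at h1 ⊢
    have h3 : m + 1 = q := by exact_mod_cast h1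
    congr 1
    omega
  · -- rank of the complement in M ／ {e}
    rw [gr_contract, erase_sdiff_erase]
    have hX : (((gr M \ B).erase e : Finset α) : Set α) ⊆ M.E \ {e} := by
      rw [Finset.coe_erase]
      exact Set.sdiff_subset_sdiff_left (by rw [← coe_gr]; exact_mod_cast Finset.sdiff_subset)
    have h1 := contract_singleton_eRk_add_one he hX
    have h2 : insert e (((gr M \ B).erase e : Finset α) : Set α) = insert e ((gr M \ B : Finset α) : Set α) := by
      rw [Finset.coe_erase, Set.insert_sdiff_singleton]
    -- r_M(insert e (E ∖ B)) = q + 2: at least r_M(E ∖ B) = q + 2, at most r(M) = q + 2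
    have h3 : M.eRk (insert e ((gr M \ B : Finset α) : Set α)) = ((q + 2 : ℕ) : ℕ∞) := by
      apply le_antisymm
      · rw [← hM]; exact M.eRk_le_eRank _
      · rw [← hBc]; exact M.eRk_mono (Set.subset_insert _ _)
    rw [h2, h3] at h1
    obtain ⟨m, hm⟩ := exists_nat_eq_eRk (M ／ ({e} : Set α)) ((gr M \ B).erase e)
    rw [← hm] at h1 ⊢
    have h4 : m + 1 = q + 2 := by exact_mod_cast h1
    congr 1
    omega

omit [DecidableEq α] in
/-- A middle-level set of `M ／ {e}` at `(q + 1, q − 1)` has rank exactly `q` there. -/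
theorem eRk_eq_of_mem_Yq_contract (hq : 1 ≤ q) {S : Finset α}
    (hS : S ∈ Yq (M ／ ({e} : Set α)) (q + 1) (q - 1)) :
    (M ／ ({e} : Set α)).eRk (S : Set α) = (q : ℕ∞) := by
  unfold Yq at hS
  rw [Finset.mem_filter, Finset.mem_powerset] at hS
  obtain ⟨-, h1, h2⟩ := hS
  obtain ⟨m, hm⟩ := exists_nat_eq_eRk (M ／ ({e} : Set α)) S
  rw [← hm] at h1 h2 ⊢
  have h1' : q - 1 < m := by exact_mod_cast h1
  have h2' : m < q + 1 := by exact_mod_cast h2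
  congr 1
  omega

/-- A middle-level set `S′` of `M ／ {e}` above `B ∖ {e}` (for some `B ∈ 𝒜`) gives the middle-level set `S′ ∪ {e}`
of `M` above `B`; such sets avoid `e`. -/
theorem insert_mem_shadow_of_contract (he : M.Indep {e}) (hq : 1 ≤ q) {𝒜 : Finset (Finset α)}
    {S : Finset α} (hS : S ∈ shadow (M ／ ({e} : Set α)) (q + 1) (q - 1) (𝒜.image (fun B => B.erase e))) :
    e ∉ S ∧ insert e S ∈ shadow M (q + 2) q 𝒜 := by
  have heE : e ∈ M.E := he.subset_ground (Set.mem_singleton e)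
  rw [mem_shadow] at hS
  obtain ⟨hY, B', hB', hB'S⟩ := hS
  have hSg : S ⊆ (gr M).erase e := by
    have := (Finset.mem_powerset.1 (Finset.mem_filter.1 hY).1)
    rwa [gr_contract] at this
  have heS : e ∉ S := fun h => (Finset.mem_erase.1 (hSg h)).1 rfl
  have hSg' : S ⊆ gr M := hSg.trans (Finset.erase_subset _ _)
  refine ⟨heS, ?_⟩
  rw [mem_shadow]
  refine ⟨?_, ?_⟩
  · -- rank of insert e S in M is q + 1
    have hX : ((S : Finset α) : Set α) ⊆ M.E \ {e} := by
      rw [← coe_gr, ← Finset.coe_erase]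
      exact_mod_cast hSg
    have h1 := contract_singleton_eRk_add_one he hX
    rw [eRk_eq_of_mem_Yq_contract hq hY] at h1
    have hr : M.eRk ((insert e S : Finset α) : Set α) = ((q + 1 : ℕ) : ℕ∞) := by
      rw [Finset.coe_insert, ← h1]
      push_cast
      rfl
    unfold Yq
    rw [Finset.mem_filter, Finset.mem_powerset, hr]
    refine ⟨Finset.insert_subset (by rw [← Finset.mem_coe, coe_gr]; exact heE) hSg', ?_, ?_⟩
    · exact_mod_cast (by omega : q < q + 1)
    · exact_mod_cast (by omega : q + 1 < q + 2)
  · rw [Finset.mem_image] at hB'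
    obtain ⟨B, hB, rfl⟩ := hB'
    refine ⟨B, hB, ?_⟩
    calc B ⊆ insert e (B.erase e) := Finset.insert_erase_subset e B
      _ ⊆ insert e S := Finset.insert_subset_insert e hB'S

/-- A collision member (`e ∉ B`, `B ∪ {e} ∈ Uq M (q + 2) q`) is a bottom set of `M ＼ {e}` at `(q + 2, q)`. -/
theorem mem_Uq_delete_of_insert_mem {B : Finset α} (hB : B ∈ Uq M (q + 2) q) (heB : e ∉ B)
    (hBe : insert e B ∈ Uq M (q + 2) q) : B ∈ Uq (M ＼ ({e} : Set α)) (q + 2) q := by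
  rw [mem_Uq] at hB hBe ⊢
  obtain ⟨hBg, hBq, -⟩ := hB
  obtain ⟨-, -, hBec⟩ := hBe
  have hX : ((B : Finset α) : Set α) ⊆ M.E \ {e} := by
    rw [← coe_gr, ← Finset.coe_erase]
    exact_mod_cast (Finset.subset_erase.2 ⟨hBg, heB⟩)
  refine ⟨?_, ?_, ?_⟩
  · rw [gr_delete]; exact Finset.subset_erase.2 ⟨hBg, heB⟩
  · rw [delete_singleton_eRk_eq hX, hBq]
  · rw [gr_delete]
    have h1 : (gr M).erase e \ B = gr M \ insert e B := by
      ext x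
      simp only [Finset.mem_sdiff, Finset.mem_erase, Finset.mem_insert]
      tauto
    rw [h1]
    have hX' : ((gr M \ insert e B : Finset α) : Set α) ⊆ M.E \ {e} := by
      rw [← coe_gr, ← Finset.coe_erase]
      have hsub : gr M \ insert e B ⊆ (gr M).erase e := by
        intro x hx
        rw [Finset.mem_sdiff, Finset.mem_insert] at hx
        rw [Finset.mem_erase]
        exact ⟨fun h => hx.2 (Or.inl h), hx.1⟩
      exact_mod_cast hsub
    rw [delete_singleton_eRk_eq hX', hBec]

/-- The middle-level sets of `M ＼ {e}` above a family `𝒞 ⊆ 𝒜` are middle-level sets of `M` above `𝒜`, avoiding `e`. -/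
theorem shadow_delete_subset {𝒜 𝒞 : Finset (Finset α)} (h𝒞 : 𝒞 ⊆ 𝒜) :
    ∀ S ∈ shadow (M ＼ ({e} : Set α)) (q + 2) q 𝒞, e ∉ S ∧ S ∈ shadow M (q + 2) q 𝒜 := by
  intro S hS
  rw [mem_shadow] at hS
  obtain ⟨hY, B, hB, hBS⟩ := hS
  unfold Yq at hY
  rw [Finset.mem_filter, Finset.mem_powerset, gr_delete] at hY
  obtain ⟨hSg, h1, h2⟩ := hY
  have heS : e ∉ S := fun h => (Finset.mem_erase.1 (hSg h)).1 rfl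
  have hX : ((S : Finset α) : Set α) ⊆ M.E \ {e} := by
    rw [← coe_gr, ← Finset.coe_erase]
    exact_mod_cast hSg
  rw [delete_singleton_eRk_eq hX] at h1 h2
  refine ⟨heS, ?_⟩
  rw [mem_shadow]
  refine ⟨?_, B, h𝒞 hB, hBS⟩
  unfold Yq
  rw [Finset.mem_filter, Finset.mem_powerset]
  exact ⟨hSg.trans (Finset.erase_subset _ _), h1, h2⟩

/-- **The contraction regime of the inductive step.**  If `e` (a non-loop) lies in the closure of every member of
`𝒜 ⊆ Uq M (q + 2) q`, `r(M) = q + 2` and `q ≥ 1`, then the shadow condition for `𝒜` at `(q + 2)/(q + 1)` follows from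
the shadow conditions of `M ／ {e}` at `(q + 1, q − 1)` (constant `(q + 1)/q`) and of `M ＼ {e}` at `(q + 2, q)`. -/
theorem shadow_card_of_mem_closure (he : M.Indep {e}) (hq : 1 ≤ q) (hM : M.eRank = ((q + 2 : ℕ) : ℕ∞))
    {𝒜 : Finset (Finset α)} (h𝒜 : 𝒜 ⊆ Uq M (q + 2) q) (hcl : ∀ B ∈ 𝒜, e ∈ clF M B)
    (IHc : ShadowHall (M ／ ({e} : Set α)) (q + 1) (q - 1) (((q : ℚ) + 1) / q))
    (IHd : ShadowHall (M ＼ ({e} : Set α)) (q + 2) q (((q : ℚ) + 2) / (q + 1))) :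
    ((q + 2 : ℚ) / (q + 1)) * (𝒜.card : ℚ) ≤ ((shadow M (q + 2) q 𝒜).card : ℚ) := by
  classical
  -- the contracted family and the collision family
  set 𝒜' : Finset (Finset α) := 𝒜.image (fun B => B.erase e) with h𝒜'
  set 𝒞 : Finset (Finset α) := 𝒜.filter (fun B => e ∉ B ∧ insert e B ∈ 𝒜) with h𝒞
  have h𝒞sub : 𝒞 ⊆ 𝒜 := Finset.filter_subset _ _
  -- 𝒜' ⊆ Uq (M ／ {e}) (q+1) (q-1)
  have h𝒜'U : 𝒜' ⊆ Uq (M ／ ({e} : Set α)) (q + 1) (q - 1) := by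
    intro B' hB'
    rw [h𝒜', Finset.mem_image] at hB'
    obtain ⟨B, hB, rfl⟩ := hB'
    exact erase_mem_Uq_contract he hq hM (h𝒜 hB) (hcl B hB)
  -- 𝒞 ⊆ Uq (M ＼ {e}) (q+2) q
  have h𝒞U : 𝒞 ⊆ Uq (M ＼ ({e} : Set α)) (q + 2) q := by
    intro B hB
    rw [h𝒞, Finset.mem_filter] at hB
    exact mem_Uq_delete_of_insert_mem (h𝒜 hB.1) hB.2.1 (h𝒜 hB.2.2)
  -- #𝒜 ≤ #𝒜' + #𝒞 : erase is injective on 𝒜 ∖ 𝒞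
  have hcount : 𝒜.card ≤ 𝒜'.card + 𝒞.card := by
    have h1 : (𝒜 \ 𝒞).card ≤ 𝒜'.card := by
      apply Finset.card_le_card_of_injOn (fun B => B.erase e)
      · intro B hB
        rw [Finset.coe_sdiff] at hB
        exact Finset.mem_image_of_mem _ hB.1
      · intro B₁ hB₁ B₂ hB₂ h12
        rw [Finset.coe_sdiff] at hB₁ hB₂
        obtain ⟨hB₁A, hB₁C⟩ := hB₁
        obtain ⟨hB₂A, hB₂C⟩ := hB₂
        have h12' : B₁.erase e = B₂.erase e := h12
        by_contra hne
        -- exactly one of B₁, B₂ contains e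
        by_cases h1e : e ∈ B₁
        · by_cases h2e : e ∈ B₂
          · apply hne
            rw [← Finset.insert_erase h1e, ← Finset.insert_erase h2e, h12']
          · -- B₁ = insert e B₂, so B₂ ∈ 𝒞
            apply hB₂C
            rw [Finset.mem_coe, h𝒞, Finset.mem_filter]
            refine ⟨hB₂A, h2e, ?_⟩
            have : insert e B₂ = B₁ := by
              rw [← Finset.insert_erase h1e, h12', Finset.erase_eq_of_notMem h2e]
            rw [this]; exact hB₁A
        · by_cases h2e : e ∈ B₂
          · apply hB₁C
            rw [Finset.mem_coe, h𝒞, Finset.mem_filter]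
            refine ⟨hB₁A, h1e, ?_⟩
            have : insert e B₁ = B₂ := by
              rw [← Finset.insert_erase h2e, ← h12', Finset.erase_eq_of_notMem h1e]
            rw [this]; exact hB₂A
          · apply hne
            rw [← Finset.erase_eq_of_notMem h1e, ← Finset.erase_eq_of_notMem h2e, h12']
    have h2 : 𝒜.card = (𝒜 \ 𝒞).card + 𝒞.card := by
      rw [Finset.card_sdiff_add_card_eq_card h𝒞sub]
    omega
  -- the two IH shadows inside the shadow of 𝒜, in the halves e ∈ S / e ∉ S
  set S1 : Finset (Finset α) := (shadow (M ／ ({e} : Set α)) (q + 1) (q - 1) 𝒜').image (fun S => insert e S) with hS1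
  have hS1card : S1.card = (shadow (M ／ ({e} : Set α)) (q + 1) (q - 1) 𝒜').card := by
    apply Finset.card_image_of_injOn
    intro S hS S' hS' hSS'
    have h1 : e ∉ S := (insert_mem_shadow_of_contract he hq (𝒜 := 𝒜) (by rwa [← h𝒜'])).1
    have h2 : e ∉ S' := (insert_mem_shadow_of_contract he hq (𝒜 := 𝒜) (by rwa [← h𝒜'])).1
    have hSS'' : insert e S = insert e S' := hSS'
    calc S = (insert e S).erase e := (Finset.erase_insert h1).symm
      _ = (insert e S').erase e := by rw [hSS'']
      _ = S' := Finset.erase_insert h2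
  have hS1sub : S1 ⊆ shadow M (q + 2) q 𝒜 := by
    intro S hS
    rw [hS1, Finset.mem_image] at hS
    obtain ⟨S', hS', rfl⟩ := hS
    exact (insert_mem_shadow_of_contract he hq (𝒜 := 𝒜) (by rwa [← h𝒜'])).2
  have hS1e : ∀ S ∈ S1, e ∈ S := by
    intro S hS
    rw [hS1, Finset.mem_image] at hS
    obtain ⟨S', -, rfl⟩ := hS
    exact Finset.mem_insert_self _ _
  set S0 : Finset (Finset α) := shadow (M ＼ ({e} : Set α)) (q + 2) q 𝒞 with hS0
  have hS0sub : S0 ⊆ shadow M (q + 2) q 𝒜 := fun S hS => (shadow_delete_subset h𝒞sub S hS).2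
  have hS0e : ∀ S ∈ S0, e ∉ S := fun S hS => (shadow_delete_subset h𝒞sub S hS).1
  have hdisj : Disjoint S1 S0 := by
    rw [Finset.disjoint_left]
    intro S h1 h0
    exact hS0e S h0 (hS1e S h1)
  have hunion : (S1 ∪ S0).card ≤ (shadow M (q + 2) q 𝒜).card :=
    Finset.card_le_card (Finset.union_subset hS1sub hS0sub)
  rw [Finset.card_union_of_disjoint hdisj, hS1card] at hunion
  -- the induction hypotheses
  have hIH1 := IHc 𝒜' h𝒜'U
  have hIH0 := IHd 𝒞 h𝒞U
  -- arithmetic in ℚ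
  have hq0 : (0 : ℚ) < (q : ℚ) := by exact_mod_cast hq
  have hq1 : (0 : ℚ) < (q : ℚ) + 1 := by positivity
  have hA : ((q : ℚ) + 1) / q ≥ ((q : ℚ) + 2) / (q + 1) := by
    rw [ge_iff_le, div_le_div_iff₀ hq1 hq0]
    nlinarith
  have hcount' : (𝒜.card : ℚ) ≤ (𝒜'.card : ℚ) + (𝒞.card : ℚ) := by exact_mod_cast hcount
  have hunion' : ((shadow (M ／ ({e} : Set α)) (q + 1) (q - 1) 𝒜').card : ℚ) + (S0.card : ℚ)
      ≤ ((shadow M (q + 2) q 𝒜).card : ℚ) := by exact_mod_cast hunion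
  have hA'nonneg : (0 : ℚ) ≤ (𝒜'.card : ℚ) := by positivity
  calc ((q + 2 : ℚ) / (q + 1)) * (𝒜.card : ℚ)
      ≤ ((q + 2 : ℚ) / (q + 1)) * ((𝒜'.card : ℚ) + (𝒞.card : ℚ)) := by
        apply mul_le_mul_of_nonneg_left hcount' (by positivity)
    _ = ((q + 2 : ℚ) / (q + 1)) * (𝒜'.card : ℚ) + ((q + 2 : ℚ) / (q + 1)) * (𝒞.card : ℚ) := by ring
    _ ≤ (((q : ℚ) + 1) / q) * (𝒜'.card : ℚ) + ((q + 2 : ℚ) / (q + 1)) * (𝒞.card : ℚ) := by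
        have := mul_le_mul_of_nonneg_right hA hA'nonneg
        linarith
    _ ≤ ((shadow (M ／ ({e} : Set α)) (q + 1) (q - 1) 𝒜').card : ℚ) + (S0.card : ℚ) := by
        apply add_le_add
        · exact hIH1
        · exact hIH0
    _ ≤ ((shadow M (q + 2) q 𝒜).card : ℚ) := hunion'

end Contract

end PercRepro.Shadow
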